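import Mathlib
import Summits.Ventures.PercRepro2.Tail2D
import Summits.Ventures.PercRepro2.Tail2DWeights
import Summits.Ventures.PercRepro2.Tail2DBundle
import Summits.Ventures.PercRepro2.Tail2DSP

/-!
# The three local conditions give the M♮ exchange axiom (seat mine-b, cell pub-perc-repro2)

`IsMTail` (Tail2D.lean) asks for three local inequalities `m1`, `m2`, `m4` (the row / column consequences are in Tail2DSP.lean).  Here they are shown to imply
the exchange axiom of M♮-concavity for `log T` in the form used by the census code of
conjectures/MINE-B.md §30.12: for `x₁ > y₁`, `T x · T y ≤ T (x - e₁) · T (y + e₁)`, or `x₂ < y₂` and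
`T x · T y ≤ T (x - e₁ + e₂) · T (y + e₁ - e₂)` (`exchange₁`), and symmetrically (`exchange₂`).  The proof
iterates the monotonicity of the three difference ratios `T(z+e₁)/T(z)`, `T(z+e₂)/T(z)`, `T(z+w)/T(z)`
(`w = (1,-1)`) along the cones on which `m1`, `m2`, `m4` make them monotone; zeros are handled by one
cancellation lemma (`ratio_chain`) and the support description of `IsMTail`.
-/

namespace Summit.Ventures.PercRepro2.Tail2D

/-- the cancellation step of every ratio iteration: from `M Q ≤ R N` and `P N ≤ M S` conclude `P Q ≤ R S`,
provided `M = 0` forces `P Q = 0`. -/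
lemma ratio_chain {P Q R S M N : ℝ} (hP : 0 ≤ P) (hR : 0 ≤ R) (hS : 0 ≤ S) (hM : 0 ≤ M)
    (hz : M = 0 → P * Q = 0) (ih : M * Q ≤ R * N) (step : P * N ≤ M * S) : P * Q ≤ R * S := by
  by_cases hM0 : M = 0
  · rw [hz hM0]; exact mul_nonneg hR hS
  · have hMpos : 0 < M := lt_of_le_of_ne hM (Ne.symm hM0)
    have key : P * Q * M ≤ R * S * M := by
      calc P * Q * M = P * (M * Q) := by ring
        _ ≤ P * (R * N) := mul_le_mul_of_nonneg_left ih hP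
        _ = R * (P * N) := by ring
        _ ≤ R * (M * S) := mul_le_mul_of_nonneg_left step hR
        _ = R * S * M := by ring
    exact le_of_mul_le_mul_right key hMpos

namespace IsMTail

variable {T : ℤ → ℤ → ℝ} {L : ℤ} (hT : IsMTail T L)

include hT

/-- `Δ₁ log T` non-increasing along `e₂`, `n` steps (from `m1`) -/
lemma d1_e2 (a b : ℤ) (n : ℕ) : T (a + 1) (b + n) * T a b ≤ T (a + 1) b * T a (b + n) := by
  induction n with
  | zero => simp [mul_comm]
  | succ n ih =>
    have e : b + ((n + 1 : ℕ) : ℤ) = b + n + 1 := by push_cast; ring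
    rw [e]
    have step : T (a + 1) (b + n + 1) * T a (b + n) ≤ T (a + 1) (b + n) * T a (b + n + 1) := hT.m1 a (b + n)
    refine ratio_chain (hT.nonneg _ _) (hT.nonneg _ _) (hT.nonneg _ _) (hT.nonneg _ _) ?_ ih step
    intro hM
    have : T (a + 1) (b + n + 1) = 0 := le_antisymm (hM ▸ hT.anti₂ (a + 1) (b + n)) (hT.nonneg _ _)
    rw [this, zero_mul]

/-- `Δ₁ log T` non-increasing along `e₁`, `n` steps (from `m1` and `m2` through `row`) -/
lemma d1_e1 (a b : ℤ) (n : ℕ) : T (a + 1 + n) b * T a b ≤ T (a + 1) b * T (a + n) b := by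
  induction n with
  | zero => simp [mul_comm]
  | succ n ih =>
    have e1 : a + 1 + ((n + 1 : ℕ) : ℤ) = a + n + 2 := by push_cast; ring
    have e2 : a + ((n + 1 : ℕ) : ℤ) = a + n + 1 := by push_cast; ring
    rw [e1, e2]
    have step : T (a + n + 2) b * T (a + n) b ≤ T (a + n + 1) b * T (a + n + 1) b := hT.row (a + n) b
    have ih' : T (a + n + 1) b * T a b ≤ T (a + 1) b * T (a + n) b := by
      have e3 : a + 1 + (n : ℤ) = a + n + 1 := by ring
      rw [e3] at ih; exact ih
    refine ratio_chain (hT.nonneg _ _) (hT.nonneg _ _) (hT.nonneg _ _) (hT.nonneg _ _) ?_ ih' step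
    intro hM
    have s := hT.anti₁ (a + n + 1) b
    rw [show a + n + 1 + 1 = a + n + 2 by ring, hM] at s
    rw [le_antisymm s (hT.nonneg _ _), zero_mul]

/-- `Δ₁ log T` is non-increasing on the positive quadrant: for `a ≤ a'`, `b ≤ b'`,
`T (a'+1) b' * T a b ≤ T (a+1) b * T a' b'` -/
lemma d1_quad {a b a' b' : ℤ} (h1 : a ≤ a') (h2 : b ≤ b') : T (a' + 1) b' * T a b ≤ T (a + 1) b * T a' b' := by
  obtain ⟨m, rfl⟩ : ∃ m : ℕ, a' = a + m := ⟨(a' - a).toNat, by omega⟩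
  obtain ⟨n, rfl⟩ : ∃ n : ℕ, b' = b + n := ⟨(b' - b).toNat, by omega⟩
  -- along e₂ at column a, then along e₁ in row b + n
  have hA := hT.d1_e2 a b n
  have hB := hT.d1_e1 a (b + n) m
  -- hA : T (a+1) (b+n) * T a b ≤ T (a+1) b * T a (b+n);  hB : T (a+1+m) (b+n) * T a (b+n) ≤ T (a+1) (b+n) * T (a+m) (b+n)
  have e : a + m + 1 = a + 1 + m := by ring
  rw [e]
  refine ratio_chain (P := T (a + 1 + m) (b + n)) (Q := T a b) (R := T (a + 1) b) (S := T (a + m) (b + n))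
    (M := T (a + 1) (b + n)) (N := T a (b + n)) (hT.nonneg _ _) (hT.nonneg _ _) (hT.nonneg _ _)
    (hT.nonneg _ _) ?_ hA hB
  intro hM
  have : T (a + 1 + m) (b + n) = 0 :=
    le_antisymm (hM ▸ hT.anti₁_of_le (show a + 1 ≤ a + 1 + m by omega) (b + n)) (hT.nonneg _ _)
  rw [this, zero_mul]

/-- `Δ₂ log T` non-increasing along `e₁`, `n` steps (from `m1`) -/
lemma d2_e1 (a b : ℤ) (n : ℕ) : T (a + n) (b + 1) * T a b ≤ T a (b + 1) * T (a + n) b := by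
  induction n with
  | zero => simp [mul_comm]
  | succ n ih =>
    have e : a + ((n + 1 : ℕ) : ℤ) = a + n + 1 := by push_cast; ring
    rw [e]
    have step : T (a + n + 1) (b + 1) * T (a + n) b ≤ T (a + n) (b + 1) * T (a + n + 1) b := by
      have := hT.m1 (a + n) b; linarith [this]
    refine ratio_chain (hT.nonneg _ _) (hT.nonneg _ _) (hT.nonneg _ _) (hT.nonneg _ _) ?_ ih step
    intro hM
    have : T (a + n + 1) (b + 1) = 0 := le_antisymm (hM ▸ hT.anti₁ (a + n) (b + 1)) (hT.nonneg _ _)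
    rw [this, zero_mul]

/-- `Δ₂ log T` non-increasing along `e₂`, `n` steps (through `col`) -/
lemma d2_e2 (a b : ℤ) (n : ℕ) : T a (b + 1 + n) * T a b ≤ T a (b + 1) * T a (b + n) := by
  induction n with
  | zero => simp [mul_comm]
  | succ n ih =>
    have e1 : b + 1 + ((n + 1 : ℕ) : ℤ) = b + n + 2 := by push_cast; ring
    have e2 : b + ((n + 1 : ℕ) : ℤ) = b + n + 1 := by push_cast; ring
    rw [e1, e2]
    have step : T a (b + n + 2) * T a (b + n) ≤ T a (b + n + 1) * T a (b + n + 1) := hT.col a (b + n)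
    have ih' : T a (b + n + 1) * T a b ≤ T a (b + 1) * T a (b + n) := by
      have e3 : b + 1 + (n : ℤ) = b + n + 1 := by ring
      rw [e3] at ih; exact ih
    refine ratio_chain (hT.nonneg _ _) (hT.nonneg _ _) (hT.nonneg _ _) (hT.nonneg _ _) ?_ ih' step
    intro hM
    have s := hT.anti₂ a (b + n + 1)
    rw [show b + n + 1 + 1 = b + n + 2 by ring, hM] at s
    rw [le_antisymm s (hT.nonneg _ _), zero_mul]

/-- `Δ₂ log T` is non-increasing on the positive quadrant -/
lemma d2_quad {a b a' b' : ℤ} (h1 : a ≤ a') (h2 : b ≤ b') : T a' (b' + 1) * T a b ≤ T a (b + 1) * T a' b' := by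
  obtain ⟨m, rfl⟩ : ∃ m : ℕ, a' = a + m := ⟨(a' - a).toNat, by omega⟩
  obtain ⟨n, rfl⟩ : ∃ n : ℕ, b' = b + n := ⟨(b' - b).toNat, by omega⟩
  have hA := hT.d2_e1 a b m
  have hB := hT.d2_e2 (a + m) b n
  have e : b + n + 1 = b + 1 + n := by ring
  rw [e]
  refine ratio_chain (P := T (a + m) (b + 1 + n)) (Q := T a b) (R := T a (b + 1)) (S := T (a + m) (b + n))
    (M := T (a + m) (b + 1)) (N := T (a + m) b) (hT.nonneg _ _) (hT.nonneg _ _) (hT.nonneg _ _)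
    (hT.nonneg _ _) ?_ hA hB
  intro hM
  have : T (a + m) (b + 1 + n) = 0 :=
    le_antisymm (hM ▸ hT.anti₂_of_le (a + m) (show b + 1 ≤ b + 1 + n by omega)) (hT.nonneg _ _)
  rw [this, zero_mul]

/-- `T(z+w)/T(z)` non-increasing along `e₁`, `n` steps (from `m2`): `T (a+n+1) (b-1) * T a b ≤ T (a+1) (b-1) * T (a+n) b` -/
lemma dw_e1 (a b : ℤ) (n : ℕ) : T (a + n + 1) (b - 1) * T a b ≤ T (a + 1) (b - 1) * T (a + n) b := by
  induction n with
  | zero => simp [mul_comm]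
  | succ n ih =>
    have e1 : a + ((n + 1 : ℕ) : ℤ) + 1 = a + n + 2 := by push_cast; ring
    have e2 : a + ((n + 1 : ℕ) : ℤ) = a + n + 1 := by push_cast; ring
    rw [e1, e2]
    have step : T (a + n + 2) (b - 1) * T (a + n) b ≤ T (a + n + 1) (b - 1) * T (a + n + 1) b := by
      have := hT.m2 (a + n) b; linarith [this]
    refine ratio_chain (hT.nonneg _ _) (hT.nonneg _ _) (hT.nonneg _ _) (hT.nonneg _ _) ?_ ih step
    intro hM
    have s := hT.anti₁ (a + n + 1) (b - 1)
    rw [show a + n + 1 + 1 = a + n + 2 by ring, hM] at s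
    rw [le_antisymm s (hT.nonneg _ _), zero_mul]

/-- `T(z+w)/T(z)` non-increasing along `-e₂`, `n` steps (from `m4`):
`T (a+1) (b-n-1) * T a b ≤ T (a+1) (b-1) * T a (b-n)` -/
lemma dw_me2 (a b : ℤ) (n : ℕ) : T (a + 1) (b - n - 1) * T a b ≤ T (a + 1) (b - 1) * T a (b - n) := by
  induction n with
  | zero => simp [mul_comm]
  | succ n ih =>
    have e1 : b - ((n + 1 : ℕ) : ℤ) - 1 = b - n - 2 := by push_cast; ring
    have e2 : b - ((n + 1 : ℕ) : ℤ) = b - n - 1 := by push_cast; ring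
    rw [e1, e2]
    -- m4 at (a + 1, b - n - 2): T a (b-n) * T (a+1) (b-n-2) ≤ T (a+1) (b-n-1) * T a (b-n-1)
    have step : T (a + 1) (b - n - 2) * T a (b - n) ≤ T (a + 1) (b - n - 1) * T a (b - n - 1) := by
      have := hT.m4 (a + 1) (b - n - 2)
      rw [show a + 1 - 1 = a by ring, show b - n - 2 + 2 = b - n by ring, show b - n - 2 + 1 = b - n - 1 by ring] at this
      linarith [this]
    refine ratio_chain (hT.nonneg _ _) (hT.nonneg _ _) (hT.nonneg _ _) (hT.nonneg _ _) ?_ ih step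
    intro hM
    -- M = T (a+1) (b-n-1) = 0 forces P Q = T (a+1) (b-n-2) * T a b = 0 by the support shape
    rw [hT.eq_zero_iff] at hM
    by_cases hP : T (a + 1) (b - n - 2) = 0
    · rw [hP, zero_mul]
    · have hQ : T a b = 0 := by
        rw [hT.eq_zero_iff]
        have := (hT.pos_iff (a + 1) (b - n - 2)).mp (lt_of_le_of_ne (hT.nonneg _ _) (Ne.symm hP))
        omega
      rw [hQ, mul_zero]

/-- `T(z+w)/T(z)` is non-increasing on the fourth quadrant: for `a ≤ a'`, `b' ≤ b`,
`T (a'+1) (b'-1) * T a b ≤ T (a+1) (b-1) * T a' b'` -/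
lemma dw_cone {a b a' b' : ℤ} (h1 : a ≤ a') (h2 : b' ≤ b) : T (a' + 1) (b' - 1) * T a b ≤ T (a + 1) (b - 1) * T a' b' := by
  obtain ⟨m, rfl⟩ : ∃ m : ℕ, a' = a + m := ⟨(a' - a).toNat, by omega⟩
  obtain ⟨n, rfl⟩ : ∃ n : ℕ, b' = b - n := ⟨(b - b').toNat, by omega⟩
  -- first along -e₂ in column a, then along e₁ in row b - n
  have hA := hT.dw_me2 a b n
  -- hA : T (a+1) (b-n-1) * T a b ≤ T (a+1) (b-1) * T a (b-n)
  have hB := hT.dw_e1 a (b - n) m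
  -- hB : T (a+m+1) (b-n-1) * T a (b-n) ≤ T (a+1) (b-n-1) * T (a+m) (b-n)
  refine ratio_chain (P := T (a + m + 1) (b - n - 1)) (Q := T a b) (R := T (a + 1) (b - 1)) (S := T (a + m) (b - n))
    (M := T (a + 1) (b - n - 1)) (N := T a (b - n)) (hT.nonneg _ _) (hT.nonneg _ _) (hT.nonneg _ _)
    (hT.nonneg _ _) ?_ hA hB
  intro hM
  have s := hT.anti₁_of_le (show a + 1 ≤ a + m + 1 by omega) (b - n - 1)
  rw [hM] at s
  rw [le_antisymm s (hT.nonneg _ _), zero_mul]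

/-- the mirror: `T(z-w)/T(z)` is non-increasing on the second quadrant: for `a' ≤ a`, `b ≤ b'`,
`T (a'-1) (b'+1) * T a b ≤ T (a-1) (b+1) * T a' b'` -/
lemma dmw_cone {a b a' b' : ℤ} (h1 : a' ≤ a) (h2 : b ≤ b') : T (a' - 1) (b' + 1) * T a b ≤ T (a - 1) (b + 1) * T a' b' := by
  -- apply `dw_cone` to the colour-swapped tail
  have hS := hT.swap
  have := hS.dw_cone (a := b) (b := a) (a' := b') (b' := a') h2 h1
  linarith [this]

/-- **the M♮ exchange axiom, first coordinate**: if `y₁ < x₁` then either `T x · T y ≤ T (x-e₁) · T (y+e₁)`,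
or `x₂ < y₂` and `T x · T y ≤ T (x-e₁+e₂) · T (y+e₁-e₂)`. -/
theorem exchange₁ {x₁ x₂ y₁ y₂ : ℤ} (h : y₁ < x₁) :
    T x₁ x₂ * T y₁ y₂ ≤ T (x₁ - 1) x₂ * T (y₁ + 1) y₂ ∨
      (x₂ < y₂ ∧ T x₁ x₂ * T y₁ y₂ ≤ T (x₁ - 1) (x₂ + 1) * T (y₁ + 1) (y₂ - 1)) := by
  by_cases h2 : y₂ ≤ x₂
  · left
    -- Δ₁ on the quadrant between y and x - e₁
    have := hT.d1_quad (a := y₁) (b := y₂) (a' := x₁ - 1) (b' := x₂) (by omega) h2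
    rw [show x₁ - 1 + 1 = x₁ by ring] at this
    linarith [this]
  · right
    have h2 : x₂ < y₂ := not_le.mp h2
    refine ⟨h2, ?_⟩
    -- the w-ratio on the fourth quadrant between y and x - w
    have := hT.dw_cone (a := y₁) (b := y₂) (a' := x₁ - 1) (b' := x₂ + 1) (by omega) (by omega)
    rw [show x₁ - 1 + 1 = x₁ by ring, show x₂ + 1 - 1 = x₂ by ring] at this
    linarith [this]

/-- **the M♮ exchange axiom, second coordinate** -/
theorem exchange₂ {x₁ x₂ y₁ y₂ : ℤ} (h : y₂ < x₂) :
    T x₁ x₂ * T y₁ y₂ ≤ T x₁ (x₂ - 1) * T y₁ (y₂ + 1) ∨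
      (x₁ < y₁ ∧ T x₁ x₂ * T y₁ y₂ ≤ T (x₁ + 1) (x₂ - 1) * T (y₁ - 1) (y₂ + 1)) := by
  by_cases h1 : y₁ ≤ x₁
  · left
    have := hT.d2_quad (a := y₁) (b := y₂) (a' := x₁) (b' := x₂ - 1) h1 (by omega)
    rw [show x₂ - 1 + 1 = x₂ by ring] at this
    linarith [this]
  · right
    have h1 : x₁ < y₁ := not_le.mp h1
    refine ⟨h1, ?_⟩
    have := hT.dmw_cone (a := y₁) (b := y₂) (a' := x₁ + 1) (b' := x₂ - 1) (by omega) (by omega)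
    rw [show x₁ + 1 - 1 = x₁ by ring, show x₂ - 1 + 1 = x₂ by ring] at this
    linarith [this]

end IsMTail

end Summit.Ventures.PercRepro2.Tail2D
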